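import Summits.Ventures.Crystal3D.Theorems.StickyWulffConstantCoaxialWallLawEndRowDefs
import HarnessLib

/-!
# Definitions: the word-end multiplicity ROW with the PREDECESSOR CLAUSE (A) — lane F's census object at key v2(A)

HONEST FRAMING. Venture `Summits/Ventures/Crystal3D` (cell `crystal3d-full`), crux `CoaxialWallLaw`
(stmt-Ventures-19481, `route-Ventures-StickyWulffConstant`), REGISTERED line `WallLedgerF` (planner cf-p1).  DEFINITIONS
ONLY; nothing is claimed here.  cf-p1 DECISIONS (xxxviii⁗)(A) (2026-08-28T18:55:45Z), (xli′) and (xliii) (20:07:32Z): the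
census KEY OF RECORD is `(v2(A), r = 1)` — version `WordVersion.v2` (NARROW move) WITH the predecessor clause (A): a pair
`(b, q)` counts only if the mover `q` has its predecessor ball `q − d ∈ X` (every mover reached by the automaton, and
every source, has it; the exports of the version-parametric chain `…PayerFamilyEndsGen` … carry it verbatim) — and the
CERTIFICATE CONSTANT OF RECORD is `s_F* := 9/2` (running census maximum `1783/420 = 4.2452`, two lineages).  The v1 rows
are retired (refuted in the kernel by 19481-p1, `not_endRowTrans_v1_two_sqrt_six`), and the `v2` TEXT rows of
`…EndRowDefs` (no clause) read `439/90 > 9/2` on the fault pair of record, so the STEP-2 glue is re-cut to consume: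

* `IsEndPairA X v S₁ S₂ b q` — `IsEndPair` with the predecessor clause `q − d ∈ X` inside the class witness;
* `endMultA`, `LocalEndRowA v s_F S₁ S₂`, `EndRowTransA v s_F`, `EndRowTwinHalfTurnA v s_F` — verbatim the objects of
  `…EndRowDefs` with `IsEndPairA` in place of `IsEndPair` (pooling radius `1`; the radius-`r` variants are insurance and
  not posited here);
* `isEndPair_of_isEndPairA`, `endMultA_le_endMult`, `localEndRowA_of_localEndRow` — clause (A) only REMOVES pairs, so
  every text row implies its (A) row (the (A) rows are the WEAKER hypotheses).
WHAT THIS IS NOT: no census fact is proved; the on-site / tail decomposition of these rows is typed elsewhere; F-C1 not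
moved.
-/

noncomputable section

namespace Summit.Ventures.Crystal3D.Theorems

open Summit.Ventures.Crystal3D Finset
open scoped InnerProductSpace

section Row

variable (X : Finset (EuclideanSpace ℝ (Fin 3)))

/-- END PAIR WITH THE PREDECESSOR CLAUSE (A): `(b, q)` is an end pair of the two-plate word net `(S₁, S₂)` under
version `v` through an admissible class `(G, d)` whose mover `q` HAS ITS PREDECESSOR BALL `q − d ∈ X`. -/
def IsEndPairA (v : WordVersion) (S₁ S₂ : PlateSystem) (b q : EuclideanSpace ℝ (Fin 3)) : Prop :=
  q ∈ X ∧ b ∈ X ∧ HasTwoPayers X b ∧ ∃ G d, (S₁.Adm G d ∨ S₂.Adm G d) ∧ q - d ∈ X ∧ IsEndMove X v G d q b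

open scoped Classical in
/-- END MULTIPLICITY under clause (A): the number of predecessor balls `q` with `(b, q)` an (A)-end pair. -/
def endMultA (v : WordVersion) (S₁ S₂ : PlateSystem) (b : EuclideanSpace ℝ (Fin 3)) : ℕ :=
  (X.filter fun q => IsEndPairA X v S₁ S₂ b q).card

end Row

open scoped Classical in
/-- **THE LOCAL ROW under clause (A)** for the plate systems `(S₁, S₂)` with constant `sF` (pooling radius `1`): for
every finite `1`-separated configuration and every payer `z`, the (A)-end balls within distance `1` of `z` load it by at
most `sF` per unit of their pooled deficiency. -/
def LocalEndRowA (v : WordVersion) (sF : ℝ) (S₁ S₂ : PlateSystem) : Prop :=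
  ∀ (X : Finset (EuclideanSpace ℝ (Fin 3))), (∀ p ∈ X, ∀ q ∈ X, p ≠ q → 1 ≤ dist p q) →
  ∀ z ∈ X, (X.filter fun q => dist z q = 1).card ≤ 11 →
    ∑ b ∈ X.filter (fun b => dist z b ≤ 1 ∧ 0 < endMultA X v S₁ S₂ b),
      (endMultA X v S₁ S₂ b : ℝ) / pooledDef X b ≤ sF

/-- **CENSUS FACT (translation pairs, in-plane roots) under clause (A).**  For every frame `L`: both plates in the
frame `L`, rising in-plane roots below, falling in-plane roots above. -/
def EndRowTransA (v : WordVersion) (sF : ℝ) : Prop :=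
  ∀ L : EuclideanSpace ℝ (Fin 3) ≃ₗᵢ[ℝ] EuclideanSpace ℝ (Fin 3),
    LocalEndRowA v sF ⟨L, inPlaneRoots L 1⟩ ⟨L, inPlaneRoots L (-1)⟩

/-- **CENSUS FACT (twins, half-turn form) under clause (A).**  For every frame `L`: bottom plate `L` with rising
in-plane roots, top plate `(ℝ ∙ e₃).reflection ≫ L` (the half-turn about `e₃` in model coordinates) with falling
in-plane roots. -/
def EndRowTwinHalfTurnA (v : WordVersion) (sF : ℝ) : Prop :=
  ∀ L : EuclideanSpace ℝ (Fin 3) ≃ₗᵢ[ℝ] EuclideanSpace ℝ (Fin 3),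
    LocalEndRowA v sF ⟨L, inPlaneRoots L 1⟩
      ⟨((ℝ ∙ EuclideanSpace.single (2 : Fin 3) (1 : ℝ)).reflection).trans L,
        inPlaneRoots (((ℝ ∙ EuclideanSpace.single (2 : Fin 3) (1 : ℝ)).reflection).trans L) (-1)⟩

/-! ### Clause (A) only removes pairs -/

/-- An (A)-end pair is an end pair. -/
theorem isEndPair_of_isEndPairA {X : Finset (EuclideanSpace ℝ (Fin 3))} {v : WordVersion} {S₁ S₂ : PlateSystem}
    {b q : EuclideanSpace ℝ (Fin 3)} (h : IsEndPairA X v S₁ S₂ b q) : IsEndPair X v S₁ S₂ b q := by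
  obtain ⟨hq, hb, hpay, G, d, hadm, -, hmove⟩ := h
  exact ⟨hq, hb, hpay, G, d, hadm, hmove⟩

open scoped Classical in
/-- `endMultA ≤ endMult`. -/
theorem endMultA_le_endMult (X : Finset (EuclideanSpace ℝ (Fin 3))) (v : WordVersion) (S₁ S₂ : PlateSystem)
    (b : EuclideanSpace ℝ (Fin 3)) : endMultA X v S₁ S₂ b ≤ endMult X v S₁ S₂ b := by
  unfold endMultA endMult
  exact card_le_card (fun q hq => mem_filter.2 ⟨(mem_filter.1 hq).1, isEndPair_of_isEndPairA (mem_filter.1 hq).2⟩)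

open scoped Classical in
/-- **The text row implies the (A) row** (same constant): clause (A) only removes pairs. -/
theorem localEndRowA_of_localEndRow {v : WordVersion} {sF : ℝ} {S₁ S₂ : PlateSystem}
    (h : LocalEndRow v sF S₁ S₂) : LocalEndRowA v sF S₁ S₂ := by
  intro X hX z hz hz11
  refine le_trans ?_ (h X hX z hz hz11)
  have hD : ∀ b, 0 ≤ pooledDef X b := by
    intro b
    refine sum_nonneg fun z' hz' => ?_
    have : ((X.filter fun q => dist z' q = 1).card : ℝ) ≤ 11 := by exact_mod_cast (mem_filter.1 hz').2.2
    linarith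
  calc ∑ b ∈ X.filter (fun b => dist z b ≤ 1 ∧ 0 < endMultA X v S₁ S₂ b), (endMultA X v S₁ S₂ b : ℝ) / pooledDef X b
      ≤ ∑ b ∈ X.filter (fun b => dist z b ≤ 1 ∧ 0 < endMultA X v S₁ S₂ b), (endMult X v S₁ S₂ b : ℝ) / pooledDef X b :=
        sum_le_sum fun b _ => div_le_div_of_nonneg_right (by exact_mod_cast endMultA_le_endMult X v S₁ S₂ b) (hD b)
    _ ≤ ∑ b ∈ X.filter (fun b => dist z b ≤ 1 ∧ 0 < endMult X v S₁ S₂ b), (endMult X v S₁ S₂ b : ℝ) / pooledDef X b := by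
        refine sum_le_sum_of_subset_of_nonneg (fun b hb => ?_) fun b _ _ => div_nonneg (Nat.cast_nonneg _) (hD b)
        obtain ⟨hbX, hd, hpos⟩ := mem_filter.1 hb
        exact mem_filter.2 ⟨hbX, hd, lt_of_lt_of_le hpos (endMultA_le_endMult X v S₁ S₂ b)⟩

/-- `EndRowTrans ⇒ EndRowTransA`, `EndRowTwinHalfTurn ⇒ EndRowTwinHalfTurnA`. -/
theorem endRowTransA_of_endRowTrans {v : WordVersion} {sF : ℝ} (h : EndRowTrans v sF) : EndRowTransA v sF :=
  fun L => localEndRowA_of_localEndRow (h L)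

/-- See `endRowTransA_of_endRowTrans`. -/
theorem endRowTwinHalfTurnA_of_endRowTwinHalfTurn {v : WordVersion} {sF : ℝ} (h : EndRowTwinHalfTurn v sF) :
    EndRowTwinHalfTurnA v sF :=
  fun L => localEndRowA_of_localEndRow (h L)

end Summit.Ventures.Crystal3D.Theorems

end
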